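import Summits.ValiantsHypothesis.ValiantsHypothesis.Theorems.LacunarySymmetroidMatrixDescartesDoorA26ClosureChamberBridge

/-!
# `DoorA26` — the census → closure bridge with ONE UNDOMINATED TIE: the two adjacent chamber rows suffice

HONEST FRAMING.  Object-search cell `pub-symmetroid`, door-A target `DoorA26 := PosRootLawAt 2 6 19`
(stmt-ValiantsHypothesis-19979; OPEN, typed, never asserted).  Seat val-sym-door-p2 g16 (#4).  A corollary of the census → closure
bridge `not_mem_closure_twentyLocus_of_sortedRows` (`…DoorA26ClosureChamberBridge`, #1), deciding nothing about the door.

SETTING.  `δ₀ ∈ ℝ⁶` monotone; an order `σ` of canonical index pairs along which the pair sums of `δ₀` increase weakly.  A tie between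
consecutive entries `σ t`, `σ (t+1)` is DOMINATED if `σ t ≤ σ (t+1)` coordinatewise (then every sorted support resolves it as `<`).
Here exactly ONE consecutive tie, at position `t₀`, may be undominated (e.g. `(i+1,i+1)` vs `(i,i+2)` at a triple `δ₀ᵢ = δ₀ᵢ₊₁ = δ₀ᵢ₊₂`,
`(0,3)` vs `(1,2)` at two pairs, `(i,i)` vs `(k,l)` on a mixed wall, `(i,j)` vs `(k,l)` on a disjoint-pair wall); all other ties of `σ`
and of the swapped order `σ' = σ ∘ swap(t₀, t₀+1)` are dominated.  Then a sorted integer support inheriting the strict inequalities of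
`δ₀` lies in the chamber of `σ`, in the chamber of `σ'`, or has the two tied sums EQUAL (a collided support, free by Descartes:
`posRootLawOn_of_pairSum_collision`) — so THE TWO ROWS of `σ` and `σ'` give `δ₀ ∉ closure TwentyLocus`
(`not_mem_closure_twentyLocus_of_twoRows`; by-id form with `σ = chamber n₁`, `σ' = chamber n₂`; `Bubbling.TwentyLocus` twins).

WHERE IT APPLIES (located CLOSURE CENSUS of this seat, memo `CLOSURE-CENSUS-g16.md`, evidence on 19979): generic MIXED-WALL points
(4 640 facets of theory g6's table, 1 292 with both adjacent chambers certified today), generic disjoint-wall points (2 238 / 901; pure ones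
are unconditional by (B)+(D) anyway), the `[3,1,1,1]`-type triple components (two refining chambers; `…TripleStratumCertifiedComponents`,
#2, does the six certified ones by hand) and the two-pair strata.  Also: `realRow_of_chamberRow` / `realRow_of_chamber` —
INTEGER CHAMBER ROWS ARE REAL CHAMBER ROWS (a certified chamber's kernel row holds for every real exponent vector of its open cone,
since `T ⊆ closure T`).  Helper `strictMono_pairSum_of_ties` is the tie-by-tie form of #3's
`strictMono_pairSum_of_dominatedTies` (a tie may instead be resolved by a given strict inequality of `d`).

Nothing here is a row or a certificate; `DoorA26`, (W), (M), (R), `MatrixDescartes` (stmt-ValiantsHypothesis-18050) OPEN; registers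
unchanged; nothing on `VP ≠ VNP`.  `--supports stmt-ValiantsHypothesis-19979 --as helper`.

[folklore] Elementary order bookkeeping; no citation exists or is needed.
-/

-- `Summit.ValiantsHypothesis.ValiantsHypothesis.…` repeats a component by the D-0017 layout
-- (single-conjunct summit), which the `dupNamespace` linter flags; the name is mandated.
set_option linter.dupNamespace false

namespace Summit.ValiantsHypothesis.ValiantsHypothesis.Theorems.LacunarySymmetroidMatrixDescartes.Census.RealExp

open Summit.ValiantsHypothesis.ValiantsHypothesis.Theorems.LacunarySymmetroidMatrixDescartes.WallBubbling

/-- **Tie by tie.**  Pair sums of a sorted support `d` (inheriting the strict canonical pair-sum inequalities of `δ₀`) increase strictly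
along `σ` as soon as every `δ₀`-tie of consecutive entries is either dominated or resolved by a given strict inequality of `d`. [this work] -/
theorem strictMono_pairSum_of_ties (δ₀ : Fin 6 → ℝ) (σ : Fin 21 → Fin 6 × Fin 6)
    (hcanon : ∀ t, (σ t).1 ≤ (σ t).2)
    (hmono : Monotone ((fun p : Fin 6 × Fin 6 => δ₀ p.1 + δ₀ p.2) ∘ σ))
    (d : Fin 6 → ℕ) (hd : StrictMono d)
    (hinh : ∀ p q : Fin 6 × Fin 6, p.1 ≤ p.2 → q.1 ≤ q.2 → δ₀ p.1 + δ₀ p.2 < δ₀ q.1 + δ₀ q.2 →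
      d p.1 + d p.2 < d q.1 + d q.2)
    (hties : ∀ t : Fin 20, δ₀ (σ t.castSucc).1 + δ₀ (σ t.castSucc).2 = δ₀ (σ t.succ).1 + δ₀ (σ t.succ).2 →
      ((σ t.castSucc).1 ≤ (σ t.succ).1 ∧ (σ t.castSucc).2 ≤ (σ t.succ).2 ∧ σ t.castSucc ≠ σ t.succ) ∨
        d (σ t.castSucc).1 + d (σ t.castSucc).2 < d (σ t.succ).1 + d (σ t.succ).2) :
    StrictMono ((fun p : Fin 6 × Fin 6 => d p.1 + d p.2) ∘ σ) := by
  refine Fin.strictMono_iff_lt_succ.mpr fun t => ?_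
  show d (σ t.castSucc).1 + d (σ t.castSucc).2 < d (σ t.succ).1 + d (σ t.succ).2
  have hle : δ₀ (σ t.castSucc).1 + δ₀ (σ t.castSucc).2 ≤ δ₀ (σ t.succ).1 + δ₀ (σ t.succ).2 :=
    hmono t.castSucc_lt_succ.le
  rcases hle.eq_or_lt with heq | hlt
  · rcases hties t heq with ⟨h1, h2, hne⟩ | hdone
    · have m1 : d (σ t.castSucc).1 ≤ d (σ t.succ).1 := hd.monotone h1
      have m2 : d (σ t.castSucc).2 ≤ d (σ t.succ).2 := hd.monotone h2
      rcases h1.eq_or_lt with e1 | l1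
      · have l2 : (σ t.castSucc).2 < (σ t.succ).2 := lt_of_le_of_ne h2 fun e2 => hne (Prod.ext e1 e2)
        have s2 : d (σ t.castSucc).2 < d (σ t.succ).2 := hd l2
        omega
      · have s1 : d (σ t.castSucc).1 < d (σ t.succ).1 := hd l1
        omega
    · exact hdone
  · exact hinh _ _ (hcanon _) (hcanon _) hlt

/-- **TWO ROWS SUFFICE FOR ONE UNDOMINATED TIE.**  `δ₀` monotone; `σ` an order of canonical pairs with `δ₀`-pair sums weakly increasing,
tied at position `t₀` (`σ t₀ ≠ σ (t₀+1)`); every OTHER tie of `σ`, and every tie of the swapped order `σ ∘ swap(t₀,t₀+1)` away from `t₀`,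
dominated.  Then the rows of `σ` and of `σ ∘ swap(t₀,t₀+1)` put `δ₀` outside `closure TwentyLocus`. [this work] -/
theorem not_mem_closure_twentyLocus_of_twoRows (δ₀ : Fin 6 → ℝ) (hδ₀ : Monotone δ₀) (σ : Fin 21 → Fin 6 × Fin 6)
    (hcanon : ∀ t, (σ t).1 ≤ (σ t).2)
    (hmono : Monotone ((fun p : Fin 6 × Fin 6 => δ₀ p.1 + δ₀ p.2) ∘ σ)) (t₀ : Fin 20)
    (htie : δ₀ (σ t₀.castSucc).1 + δ₀ (σ t₀.castSucc).2 = δ₀ (σ t₀.succ).1 + δ₀ (σ t₀.succ).2)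
    (hne : σ t₀.castSucc ≠ σ t₀.succ)
    (hties₁ : ∀ t : Fin 20, t ≠ t₀ → δ₀ (σ t.castSucc).1 + δ₀ (σ t.castSucc).2 = δ₀ (σ t.succ).1 + δ₀ (σ t.succ).2 →
      (σ t.castSucc).1 ≤ (σ t.succ).1 ∧ (σ t.castSucc).2 ≤ (σ t.succ).2 ∧ σ t.castSucc ≠ σ t.succ)
    (hties₂ : ∀ t : Fin 20, t ≠ t₀ →
      δ₀ ((σ ∘ Equiv.swap t₀.castSucc t₀.succ) t.castSucc).1 + δ₀ ((σ ∘ Equiv.swap t₀.castSucc t₀.succ) t.castSucc).2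
        = δ₀ ((σ ∘ Equiv.swap t₀.castSucc t₀.succ) t.succ).1 + δ₀ ((σ ∘ Equiv.swap t₀.castSucc t₀.succ) t.succ).2 →
      ((σ ∘ Equiv.swap t₀.castSucc t₀.succ) t.castSucc).1 ≤ ((σ ∘ Equiv.swap t₀.castSucc t₀.succ) t.succ).1 ∧
        ((σ ∘ Equiv.swap t₀.castSucc t₀.succ) t.castSucc).2 ≤ ((σ ∘ Equiv.swap t₀.castSucc t₀.succ) t.succ).2 ∧
        (σ ∘ Equiv.swap t₀.castSucc t₀.succ) t.castSucc ≠ (σ ∘ Equiv.swap t₀.castSucc t₀.succ) t.succ)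
    (hrow₁ : ∀ d : Fin 6 → ℕ, StrictMono ((fun p : Fin 6 × Fin 6 => d p.1 + d p.2) ∘ σ) → PosRootLawOn 2 6 19 d)
    (hrow₂ : ∀ d : Fin 6 → ℕ, StrictMono ((fun p : Fin 6 × Fin 6 => d p.1 + d p.2) ∘ (σ ∘ Equiv.swap t₀.castSucc t₀.succ)) →
      PosRootLawOn 2 6 19 d) :
    δ₀ ∉ closure {δ : Fin 6 → ℝ | ∃ S : Fin 6 → Matrix (Fin 2) (Fin 2) ℝ, (∀ l, (S l).IsSymm) ∧
      20 ≤ {x : ℝ | 0 < x ∧ (∑ l, (x ^ (δ l)) • S l).det = 0}.ncard} := by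
  classical
  set σ' : Fin 21 → Fin 6 × Fin 6 := σ ∘ Equiv.swap t₀.castSucc t₀.succ with hσ'
  -- the swapped order has the same `δ₀`-pair sums pointwise (the two swapped entries are tied), hence is monotone too
  have hval : ∀ x, δ₀ (σ' x).1 + δ₀ (σ' x).2 = δ₀ (σ x).1 + δ₀ (σ x).2 := by
    intro x
    simp only [hσ', Function.comp_apply]
    by_cases h1 : x = t₀.castSucc
    · subst h1; rw [Equiv.swap_apply_left, htie]
    · by_cases h2 : x = t₀.succ
      · subst h2; rw [Equiv.swap_apply_right, htie]
      · rw [Equiv.swap_apply_of_ne_of_ne h1 h2]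
  have hmono' : Monotone ((fun p : Fin 6 × Fin 6 => δ₀ p.1 + δ₀ p.2) ∘ σ') := by
    intro x y hxy
    show δ₀ (σ' x).1 + δ₀ (σ' x).2 ≤ δ₀ (σ' y).1 + δ₀ (σ' y).2
    rw [hval, hval]; exact hmono hxy
  have hcanon' : ∀ t, (σ' t).1 ≤ (σ' t).2 := fun t => hcanon _
  refine not_mem_closure_twentyLocus_of_sortedRows δ₀ hδ₀ fun d hd hinh => ?_
  rcases lt_trichotomy (d (σ t₀.castSucc).1 + d (σ t₀.castSucc).2) (d (σ t₀.succ).1 + d (σ t₀.succ).2) with hlt | heq | hgt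
  · -- the chamber of `σ`
    refine hrow₁ d (strictMono_pairSum_of_ties δ₀ σ hcanon hmono d hd hinh fun t ht => ?_)
    by_cases htt : t = t₀
    · subst htt; exact Or.inr hlt
    · exact Or.inl (hties₁ t htt ht)
  · -- collided support
    exact posRootLawOn_of_pairSum_collision d (σ t₀.castSucc) (σ t₀.succ) (hcanon _) (hcanon _) hne heq
  · -- the chamber of `σ'`
    refine hrow₂ d (strictMono_pairSum_of_ties δ₀ σ' hcanon' hmono' d hd hinh fun t ht => ?_)
    by_cases htt : t = t₀
    · subst htt
      refine Or.inr ?_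
      simp only [hσ', Function.comp_apply, Equiv.swap_apply_left, Equiv.swap_apply_right]
      exact hgt
    · exact Or.inl (hties₂ t htt ht)

/-- **By chamber ids.**  `σ := chamber n₁`, the swapped order is `chamber n₂` (hypothesis `hswap`, a `decide`-able identity of table
entries); `hrow₁`, `hrow₂` := the landed rows `doorA26_on_chamber<n₁>`, `doorA26_on_chamber<n₂>` verbatim. [this work] -/
theorem not_mem_closure_twentyLocus_of_twoChambers (δ₀ : Fin 6 → ℝ) (hδ₀ : Monotone δ₀) (n₁ n₂ : ℕ) (t₀ : Fin 20)
    (hswap : chamber n₂ = chamber n₁ ∘ Equiv.swap t₀.castSucc t₀.succ)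
    (hcanon : ∀ t, (chamber n₁ t).1 ≤ (chamber n₁ t).2)
    (hmono : Monotone ((fun p : Fin 6 × Fin 6 => δ₀ p.1 + δ₀ p.2) ∘ chamber n₁))
    (htie : δ₀ (chamber n₁ t₀.castSucc).1 + δ₀ (chamber n₁ t₀.castSucc).2
        = δ₀ (chamber n₁ t₀.succ).1 + δ₀ (chamber n₁ t₀.succ).2)
    (hne : chamber n₁ t₀.castSucc ≠ chamber n₁ t₀.succ)
    (hties₁ : ∀ t : Fin 20, t ≠ t₀ → δ₀ (chamber n₁ t.castSucc).1 + δ₀ (chamber n₁ t.castSucc).2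
        = δ₀ (chamber n₁ t.succ).1 + δ₀ (chamber n₁ t.succ).2 →
      (chamber n₁ t.castSucc).1 ≤ (chamber n₁ t.succ).1 ∧ (chamber n₁ t.castSucc).2 ≤ (chamber n₁ t.succ).2 ∧
        chamber n₁ t.castSucc ≠ chamber n₁ t.succ)
    (hties₂ : ∀ t : Fin 20, t ≠ t₀ → δ₀ (chamber n₂ t.castSucc).1 + δ₀ (chamber n₂ t.castSucc).2
        = δ₀ (chamber n₂ t.succ).1 + δ₀ (chamber n₂ t.succ).2 →
      (chamber n₂ t.castSucc).1 ≤ (chamber n₂ t.succ).1 ∧ (chamber n₂ t.castSucc).2 ≤ (chamber n₂ t.succ).2 ∧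
        chamber n₂ t.castSucc ≠ chamber n₂ t.succ)
    (hrow₁ : ∀ d : Fin 6 → ℕ, StrictMono ((fun p : Fin 6 × Fin 6 => d p.1 + d p.2) ∘ chamber n₁) → PosRootLawOn 2 6 19 d)
    (hrow₂ : ∀ d : Fin 6 → ℕ, StrictMono ((fun p : Fin 6 × Fin 6 => d p.1 + d p.2) ∘ chamber n₂) → PosRootLawOn 2 6 19 d) :
    δ₀ ∉ closure {δ : Fin 6 → ℝ | ∃ S : Fin 6 → Matrix (Fin 2) (Fin 2) ℝ, (∀ l, (S l).IsSymm) ∧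
      20 ≤ {x : ℝ | 0 < x ∧ (∑ l, (x ^ (δ l)) • S l).det = 0}.ncard} := by
  refine not_mem_closure_twentyLocus_of_twoRows δ₀ hδ₀ (chamber n₁) hcanon hmono t₀ htie hne hties₁ ?_ hrow₁ ?_
  · rw [← hswap]; exact hties₂
  · rw [← hswap]; exact hrow₂

/-- **W-line currency.** [this work] -/
theorem not_mem_closure_bubblingTwentyLocus_of_twoChambers (δ₀ : Fin 6 → ℝ) (hδ₀ : Monotone δ₀) (n₁ n₂ : ℕ) (t₀ : Fin 20)
    (hswap : chamber n₂ = chamber n₁ ∘ Equiv.swap t₀.castSucc t₀.succ)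
    (hcanon : ∀ t, (chamber n₁ t).1 ≤ (chamber n₁ t).2)
    (hmono : Monotone ((fun p : Fin 6 × Fin 6 => δ₀ p.1 + δ₀ p.2) ∘ chamber n₁))
    (htie : δ₀ (chamber n₁ t₀.castSucc).1 + δ₀ (chamber n₁ t₀.castSucc).2
        = δ₀ (chamber n₁ t₀.succ).1 + δ₀ (chamber n₁ t₀.succ).2)
    (hne : chamber n₁ t₀.castSucc ≠ chamber n₁ t₀.succ)
    (hties₁ : ∀ t : Fin 20, t ≠ t₀ → δ₀ (chamber n₁ t.castSucc).1 + δ₀ (chamber n₁ t.castSucc).2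
        = δ₀ (chamber n₁ t.succ).1 + δ₀ (chamber n₁ t.succ).2 →
      (chamber n₁ t.castSucc).1 ≤ (chamber n₁ t.succ).1 ∧ (chamber n₁ t.castSucc).2 ≤ (chamber n₁ t.succ).2 ∧
        chamber n₁ t.castSucc ≠ chamber n₁ t.succ)
    (hties₂ : ∀ t : Fin 20, t ≠ t₀ → δ₀ (chamber n₂ t.castSucc).1 + δ₀ (chamber n₂ t.castSucc).2
        = δ₀ (chamber n₂ t.succ).1 + δ₀ (chamber n₂ t.succ).2 →
      (chamber n₂ t.castSucc).1 ≤ (chamber n₂ t.succ).1 ∧ (chamber n₂ t.castSucc).2 ≤ (chamber n₂ t.succ).2 ∧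
        chamber n₂ t.castSucc ≠ chamber n₂ t.succ)
    (hrow₁ : ∀ d : Fin 6 → ℕ, StrictMono ((fun p : Fin 6 × Fin 6 => d p.1 + d p.2) ∘ chamber n₁) → PosRootLawOn 2 6 19 d)
    (hrow₂ : ∀ d : Fin 6 → ℕ, StrictMono ((fun p : Fin 6 × Fin 6 => d p.1 + d p.2) ∘ chamber n₂) → PosRootLawOn 2 6 19 d) :
    δ₀ ∉ closure Bubbling.TwentyLocus :=
  not_mem_closure_twentyLocus_of_twoChambers δ₀ hδ₀ n₁ n₂ t₀ hswap hcanon hmono htie hne hties₁ hties₂ hrow₁ hrow₂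


/-- **INTEGER CHAMBER ROWS ARE REAL CHAMBER ROWS.**  If the chamber-uniform integer row of an order `σ` holds, then every REAL exponent
vector `δ` in the open cone of `σ` (pair sums strictly increasing along `σ`) carries the real row: every six-letter real symmetric `2 × 2`
pencil `∑ x^{δ_l} S_l` has at most `19` zeros on `(0,∞)` (`δ ∈ T ⊆ closure T` would contradict `not_mem_closure_twentyLocus_of_chamberRow`).
[this work] -/
theorem realRow_of_chamberRow (δ : Fin 6 → ℝ) (σ : Fin 21 → Fin 6 × Fin 6)
    (hδ : StrictMono ((fun p : Fin 6 × Fin 6 => δ p.1 + δ p.2) ∘ σ))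
    (hrow : ∀ d : Fin 6 → ℕ, StrictMono ((fun p : Fin 6 × Fin 6 => d p.1 + d p.2) ∘ σ) → PosRootLawOn 2 6 19 d)
    (S : Fin 6 → Matrix (Fin 2) (Fin 2) ℝ) (hS : ∀ l, (S l).IsSymm) :
    {x : ℝ | 0 < x ∧ (∑ l, (x ^ (δ l)) • S l).det = 0}.ncard ≤ 19 := by
  by_contra h
  exact not_mem_closure_twentyLocus_of_chamberRow δ σ hδ hrow (subset_closure ⟨S, hS, by omega⟩)

/-- **By chamber id**: a certified chamber's KERNEL ROW (integer supports) holds for every REAL exponent vector of its open cone.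
[this work] -/
theorem realRow_of_chamber (δ : Fin 6 → ℝ) (n : ℕ)
    (hδ : StrictMono ((fun p : Fin 6 × Fin 6 => δ p.1 + δ p.2) ∘ chamber n))
    (hrow : ∀ d : Fin 6 → ℕ, StrictMono ((fun p : Fin 6 × Fin 6 => d p.1 + d p.2) ∘ chamber n) → PosRootLawOn 2 6 19 d)
    (S : Fin 6 → Matrix (Fin 2) (Fin 2) ℝ) (hS : ∀ l, (S l).IsSymm) :
    {x : ℝ | 0 < x ∧ (∑ l, (x ^ (δ l)) • S l).det = 0}.ncard ≤ 19 :=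
  realRow_of_chamberRow δ (chamber n) hδ hrow S hS

/-- Sanity of the by-id hypotheses on a real pair of adjacent chambers of the table (300 and 301 differ by swapping positions 12, 13:
`(2,4)` ↔ `(3,3)`); all three side conditions are `decide`-able. [folklore] -/
example : chamber 301 = chamber 300 ∘ Equiv.swap (12 : Fin 20).castSucc (12 : Fin 20).succ ∧
    (∀ t, (chamber 300 t).1 ≤ (chamber 300 t).2) ∧ chamber 300 (12 : Fin 20).castSucc ≠ chamber 300 (12 : Fin 20).succ := by
  refine ⟨?_, ?_, ?_⟩
  · exact funext fun t => by fin_cases t <;> rfl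
  · decide
  · decide

end Summit.ValiantsHypothesis.ValiantsHypothesis.Theorems.LacunarySymmetroidMatrixDescartes.Census.RealExp
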